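import Summits.AtomisticToContinuum.HydrodynamicLimit.Theorems.RelayRaceLocalityNearConstantShortTimeHLVelObjects
import Summits.AtomisticToContinuum.HydrodynamicLimit.Theorems.RelayRaceLocalityNearConstantShortTimeHLSt2SplitDefs
import Summits.AtomisticToContinuum.HydrodynamicLimit.Theorems.RelayRaceLocalityNearConstantShortTimeHLFluxIntegrability
import HarnessLib

/-!
# Crux `NearConstantShortTimeHL` (stmt-AtomisticToContinuum-12502), line `small-tilt-domination` — auxiliary facts for the
assembly of the conditional Gaussian chessboard estimate (`stub_velocityLD`)

Elementary properties of the objects of `…VelObjects` used when the abstract chessboard estimate is applied to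
`g(y, v) = chessIntegrand M ℓ θ₁ u₁ x v y`: nonnegativity, joint measurability in `(y, v)`, a bound uniform in the centre,
LOCALITY (the chessboard integrand at `y` depends on the velocities of the particles within minimal-image distance `ℓ` of
`y` only), the weights `linWeight ∈ [0, 1]` with `Σᵢ linWeightᵢ ≤ m · smoothedDeviation`, the identification of
`smoothedDeviation` with the position term of the domination, crowded balls consist of crowded particles, and the choice of an
even chessboard mesh `k` with `2ℓ ≤ 1/k ≤ 4ℓ`.

References: H.-T. Yau, Lett. Math. Phys. 22 (1991) §2.
-/

noncomputable section

namespace Summit.AtomisticToContinuum.HydrodynamicLimit.Theorems.NearConstantShortTimeHL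

open scoped BigOperators ENNReal
open MeasureTheory Set Filter
open Literature.MathematicalPhysics.KineticTheory Literature.Analysis.FluidPDE Literature.Analysis.FunctionSpaces

/-! ## The chessboard integrand -/

/-- The chessboard integrand is nonnegative. [folklore] -/
theorem chessIntegrand_nonneg {m : ℕ} (M ℓ : ℝ) (hM : 0 ≤ M) (θ₁ : T3 → ℝ) (u₁ : T3 → V3) (x : Fin m → T3)
    (v : Fin m → V3) (y : T3) : 0 ≤ chessIntegrand M ℓ θ₁ u₁ x v y := by
  unfold chessIntegrand
  have hρ : 0 ≤ ballDens ℓ x y :=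
    mul_nonneg (inv_nonneg.2 (Nat.cast_nonneg m)) (Finset.sum_nonneg fun i _ => ballKernel_nonneg ℓ y (x i))
  refine add_nonneg (mul_nonneg (by positivity) (le_min zero_le_one (by positivity))) (mul_nonneg two_pos.le ?_)
  split_ifs with h <;> linarith

/-- The chessboard integrand is jointly measurable in (centre, velocities). [folklore] -/
theorem measurable_chessIntegrand_uncurry {m : ℕ} (M ℓ : ℝ) (θ₁ : T3 → ℝ) (u₁ : T3 → V3) (x : Fin m → T3) :
    Measurable fun p : T3 × (Fin m → V3) => chessIntegrand M ℓ θ₁ u₁ x p.2 p.1 := by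
  unfold chessIntegrand ballDens velDev enDev
  have hK : ∀ i, Measurable fun p : T3 × (Fin m → V3) => ballKernel ℓ p.1 (x i) := fun i =>
    wg_measurable_ballKernel measurable_fst measurable_const ℓ
  have hv : ∀ i, Measurable fun p : T3 × (Fin m → V3) => p.2 i := fun i => (measurable_pi_apply i).comp measurable_snd
  have hD : Measurable fun p : T3 × (Fin m → V3) => (m : ℝ)⁻¹ * ∑ i, ballKernel ℓ p.1 (x i) :=
    (Finset.measurable_sum _ fun i _ => hK i).const_mul _
  have hV : Measurable fun p : T3 × (Fin m → V3) => (m : ℝ)⁻¹ • ∑ i, ballKernel ℓ p.1 (x i) • (p.2 i - u₁ (x i)) :=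
    (Finset.measurable_sum _ fun i _ => (hK i).smul ((hv i).sub measurable_const)).fun_const_smul _
  have hE : Measurable fun p : T3 × (Fin m → V3) =>
      (m : ℝ)⁻¹ * ∑ i, ballKernel ℓ p.1 (x i) * (‖p.2 i‖ ^ 2 / 2 - ‖u₁ (x i)‖ ^ 2 / 2 - 3 / 2 * θ₁ (x i)) :=
    (Finset.measurable_sum _ fun i _ => (hK i).mul ((((hv i).norm.pow_const 2).div_const 2).sub_const _ |>.sub_const _)).const_mul _
  refine ((measurable_const.add (measurable_const.mul (measurable_const.add (measurable_const.mul hD)))).mul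
    (measurable_const.min ((hV.norm.pow_const 2).add (hE.pow_const 2)))).add (measurable_const.mul ?_)
  exact Measurable.ite (measurableSet_lt measurable_const hE) hE measurable_const

/-- The chessboard integrand is bounded uniformly in the centre (for fixed velocities; `0 ≤ M`). [folklore] -/
theorem exists_chessIntegrand_le {m : ℕ} {M : ℝ} (hM : 0 ≤ M) (ℓ : ℝ) (θ₁ : T3 → ℝ) (u₁ : T3 → V3) (x : Fin m → T3)
    (v : Fin m → V3) : ∃ C : ℝ, ∀ y, chessIntegrand M ℓ θ₁ u₁ x v y ≤ C := by
  set Bk : ℝ := |(4 / 3 * Real.pi * ℓ ^ 3)⁻¹| with hBk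
  set SY : ℝ := ∑ i, |‖v i‖ ^ 2 / 2 - ‖u₁ (x i)‖ ^ 2 / 2 - 3 / 2 * θ₁ (x i)| with hSY
  refine ⟨(2 + 2 * (1 + (1 + (M ^ 2 / 2 + 3 / 2 * M)) * Bk)) + 2 * (Bk * SY), fun y => ?_⟩
  have hm0 : 0 ≤ (m : ℝ)⁻¹ := inv_nonneg.2 (Nat.cast_nonneg m)
  have hm1 : (m : ℝ)⁻¹ ≤ 1 := by
    rcases Nat.eq_zero_or_pos m with hm | hm
    · subst hm; simp
    · exact inv_le_one_of_one_le₀ (by exact_mod_cast hm)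
  have hρ0 : 0 ≤ ballDens ℓ x y := mul_nonneg hm0 (Finset.sum_nonneg fun i _ => ballKernel_nonneg ℓ y (x i))
  have hρB : ballDens ℓ x y ≤ Bk := by
    unfold ballDens
    calc (m : ℝ)⁻¹ * ∑ i, ballKernel ℓ y (x i) ≤ (m : ℝ)⁻¹ * ∑ _i : Fin m, Bk :=
          mul_le_mul_of_nonneg_left (Finset.sum_le_sum fun i _ => wg_ballKernel_le ℓ y (x i)) hm0
      _ = ((m : ℝ)⁻¹ * m) * Bk := by rw [Finset.sum_const, Finset.card_univ, Fintype.card_fin, nsmul_eq_mul]; ring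
      _ ≤ 1 * Bk := by
          refine mul_le_mul_of_nonneg_right ?_ (abs_nonneg _)
          rcases Nat.eq_zero_or_pos m with hm | hm
          · subst hm; simp
          · rw [inv_mul_cancel₀ (by exact_mod_cast hm.ne')]
      _ = Bk := one_mul _
  have hE : |enDev ℓ θ₁ u₁ x v y| ≤ Bk * SY := by
    unfold enDev
    rw [abs_mul, abs_of_nonneg hm0, hSY, Finset.mul_sum]
    calc (m : ℝ)⁻¹ * |∑ i, ballKernel ℓ y (x i) * (‖v i‖ ^ 2 / 2 - ‖u₁ (x i)‖ ^ 2 / 2 - 3 / 2 * θ₁ (x i))|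
        ≤ 1 * ∑ i, Bk * |‖v i‖ ^ 2 / 2 - ‖u₁ (x i)‖ ^ 2 / 2 - 3 / 2 * θ₁ (x i)| := by
          refine mul_le_mul hm1 ((Finset.abs_sum_le_sum_abs _ _).trans (Finset.sum_le_sum fun i _ => ?_))
            (abs_nonneg _) zero_le_one
          rw [abs_mul, abs_of_nonneg (ballKernel_nonneg ℓ y (x i))]
          exact mul_le_mul_of_nonneg_right (wg_ballKernel_le ℓ y (x i)) (abs_nonneg _)
      _ = _ := one_mul _
  have hmv0 : 0 ≤ min 1 (‖velDev ℓ u₁ x v y‖ ^ 2 + enDev ℓ θ₁ u₁ x v y ^ 2) := le_min zero_le_one (by positivity)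
  have hmv1 : min 1 (‖velDev ℓ u₁ x v y‖ ^ 2 + enDev ℓ θ₁ u₁ x v y ^ 2) ≤ 1 := min_le_left _ _
  have hite : (if 1 < enDev ℓ θ₁ u₁ x v y then enDev ℓ θ₁ u₁ x v y else 0) ≤ Bk * SY := by
    split_ifs with h
    · exact (le_abs_self _).trans hE
    · exact (abs_nonneg _).trans hE
  have hc : 0 ≤ 1 + (M ^ 2 / 2 + 3 / 2 * M) := by positivity
  have hcoef : (2 + 2 * (1 + (1 + (M ^ 2 / 2 + 3 / 2 * M)) * ballDens ℓ x y)) *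
      min 1 (‖velDev ℓ u₁ x v y‖ ^ 2 + enDev ℓ θ₁ u₁ x v y ^ 2) ≤ 2 + 2 * (1 + (1 + (M ^ 2 / 2 + 3 / 2 * M)) * Bk) := by
    calc _ ≤ (2 + 2 * (1 + (1 + (M ^ 2 / 2 + 3 / 2 * M)) * Bk)) * 1 := by
          refine mul_le_mul (by nlinarith [mul_le_mul_of_nonneg_left hρB hc]) hmv1 hmv0 ?_
          nlinarith [mul_nonneg hc (abs_nonneg ((4 / 3 * Real.pi * ℓ ^ 3)⁻¹))]
      _ = _ := mul_one _
  unfold chessIntegrand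
  linarith

/-- **Locality of the chessboard integrand**: at the centre `y` it depends on the velocities of the particles within
minimal-image distance `ℓ` of `y` only. [folklore] -/
theorem chessIntegrand_congr_of_ball {m : ℕ} (M ℓ : ℝ) (θ₁ : T3 → ℝ) (u₁ : T3 → V3) (x : Fin m → T3)
    {v w : Fin m → V3} {y : T3} (h : ∀ i, Torus.euclidDist y (x i) < ℓ → v i = w i) :
    chessIntegrand M ℓ θ₁ u₁ x v y = chessIntegrand M ℓ θ₁ u₁ x w y := by
  have hK : ∀ i, ¬ Torus.euclidDist y (x i) < ℓ → ballKernel ℓ y (x i) = 0 := fun i hi => by simp [ballKernel, hi]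
  have hV : velDev ℓ u₁ x v y = velDev ℓ u₁ x w y := by
    unfold velDev
    congr 1
    refine Finset.sum_congr rfl fun i _ => ?_
    by_cases hi : Torus.euclidDist y (x i) < ℓ
    · rw [h i hi]
    · rw [hK i hi, zero_smul, zero_smul]
  have hE : enDev ℓ θ₁ u₁ x v y = enDev ℓ θ₁ u₁ x w y := by
    unfold enDev
    congr 1
    refine Finset.sum_congr rfl fun i _ => ?_
    by_cases hi : Torus.euclidDist y (x i) < ℓ
    · rw [h i hi]
    · rw [hK i hi, zero_mul, zero_mul]
  unfold chessIntegrand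
  rw [hV, hE]

/-! ## The weights of the linear term -/

/-- `0 ≤ linWeight`. [folklore] -/
theorem linWeight_nonneg {m : ℕ} (ℓ : ℝ) (ρ₁ θ₁ : T3 → ℝ) (u₁ : T3 → V3) (x : Fin m → T3) (i : Fin m) :
    0 ≤ linWeight ℓ ρ₁ θ₁ u₁ x i :=
  integral_nonneg fun y => mul_nonneg (ballKernel_nonneg ℓ y (x i)) (le_min zero_le_one (by unfold posDev; positivity))

/-- `linWeight ≤ 1` for `0 < ℓ < 1/2` (the ball kernel has unit mass). [folklore] -/
theorem linWeight_le_one {m : ℕ} {ℓ : ℝ} (hℓ0 : 0 < ℓ) (hℓ : ℓ < 1 / 2) (ρ₁ θ₁ : T3 → ℝ) (u₁ : T3 → V3)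
    (x : Fin m → T3) (i : Fin m) : linWeight ℓ ρ₁ θ₁ u₁ x i ≤ 1 := by
  unfold linWeight
  have h1 : ∫ y : T3, ballKernel ℓ y (x i) = 1 := integral_ballKernel_eq_one hℓ0 hℓ (x i)
  calc ∫ y, ballKernel ℓ y (x i) * min 1 (posDev ℓ ρ₁ θ₁ u₁ x y) ≤ ∫ y, ballKernel ℓ y (x i) := by
        refine integral_mono_of_nonneg (ae_of_all _ fun y => mul_nonneg (ballKernel_nonneg ℓ y (x i))
          (le_min zero_le_one (by unfold posDev; positivity))) (integrable_ballKernel ℓ _ (x i)) (ae_of_all _ fun y => ?_)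
        calc ballKernel ℓ y (x i) * min 1 (posDev ℓ ρ₁ θ₁ u₁ x y) ≤ ballKernel ℓ y (x i) * 1 :=
              mul_le_mul_of_nonneg_left (min_le_left _ _) (ballKernel_nonneg ℓ y (x i))
          _ = ballKernel ℓ y (x i) := mul_one _
    _ = 1 := h1

/-- `smoothedDeviation` is the position term of the domination: `∫ (1 + ballDens) min 1 posDev`. [folklore] -/
theorem smoothedDeviation_eq {m : ℕ} (ℓ : ℝ) (ρ₁ θ₁ : T3 → ℝ) (u₁ : T3 → V3) (x : Fin m → T3) :
    smoothedDeviation ℓ ρ₁ θ₁ u₁ x = ∫ y, (1 + ballDens ℓ x y) * min 1 (posDev ℓ ρ₁ θ₁ u₁ x y) := rfl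

/-- `Σᵢ linWeightᵢ ≤ m · smoothedDeviation` (measurable profiles, `0 < ℓ`). [folklore] -/
theorem sum_linWeight_le : ∀ {m : ℕ} {ℓ : ℝ} {ρ₁ θ₁ : T3 → ℝ} {u₁ : T3 → V3}, Measurable ρ₁ → Measurable θ₁ → Measurable u₁ → ∀ x : Fin m → T3, ∑ i, linWeight ℓ ρ₁ θ₁ u₁ x i ≤ m * smoothedDeviation ℓ ρ₁ θ₁ u₁ x := by
  intro m ℓ ρ₁ θ₁ u₁ hρ hθ hu x
  have hPm1 : Measurable fun y => min 1 (posDev ℓ ρ₁ θ₁ u₁ x y) := by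
    unfold posDev totalEnergyDensity
    have hK : ∀ i, Measurable fun y : T3 => ballKernel ℓ y (x i) := fun i =>
      wg_measurable_ballKernel measurable_id measurable_const ℓ
    have h1 : Measurable fun y => (m : ℝ)⁻¹ * ∑ i, ballKernel ℓ y (x i) := (Finset.measurable_sum _ fun i _ => hK i).const_mul _
    have h2 : Measurable fun y => (m : ℝ)⁻¹ • ∑ i, ballKernel ℓ y (x i) • u₁ (x i) :=
      (Finset.measurable_sum _ fun i _ => (hK i).smul_const _).fun_const_smul _
    have h3 : Measurable fun y => (m : ℝ)⁻¹ * ∑ i, ballKernel ℓ y (x i) * (‖u₁ (x i)‖ ^ 2 / 2 + 3 / 2 * θ₁ (x i)) :=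
      (Finset.measurable_sum _ fun i _ => (hK i).mul_const _).const_mul _
    exact measurable_const.min ((((h1.sub hρ).pow_const 2).add ((h2.sub (hρ.smul hu)).norm.pow_const 2)).add
      ((h3.sub (hρ.mul (((hu.norm.pow_const 2).div_const 2).add (measurable_const.mul hθ)))).pow_const 2))
  have hmin0 : ∀ y, 0 ≤ min 1 (posDev ℓ ρ₁ θ₁ u₁ x y) := fun y => le_min zero_le_one (by unfold posDev; positivity)
  have hmin1 : ∀ y, min 1 (posDev ℓ ρ₁ θ₁ u₁ x y) ≤ 1 := fun y => min_le_left _ _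
  have hLi : ∀ i, Integrable fun y => ballKernel ℓ y (x i) * min 1 (posDev ℓ ρ₁ θ₁ u₁ x y) := fun i => by
    refine (integrable_const |(4 / 3 * Real.pi * ℓ ^ 3)⁻¹|).mono'
      ((wg_measurable_ballKernel measurable_id measurable_const ℓ).mul hPm1).aestronglyMeasurable (ae_of_all _ fun y => ?_)
    rw [Real.norm_eq_abs, abs_of_nonneg (mul_nonneg (ballKernel_nonneg ℓ y (x i)) (hmin0 y))]
    calc ballKernel ℓ y (x i) * min 1 (posDev ℓ ρ₁ θ₁ u₁ x y) ≤ |(4 / 3 * Real.pi * ℓ ^ 3)⁻¹| * 1 :=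
          mul_le_mul (wg_ballKernel_le ℓ y (x i)) (hmin1 y) (hmin0 y) (abs_nonneg _)
      _ = _ := mul_one _
  have hρ0 : ∀ y, 0 ≤ ballDens ℓ x y := fun y =>
    mul_nonneg (inv_nonneg.2 (Nat.cast_nonneg m)) (Finset.sum_nonneg fun i _ => ballKernel_nonneg ℓ y (x i))
  have hid : ∀ y, (m : ℝ) * (ballDens ℓ x y * min 1 (posDev ℓ ρ₁ θ₁ u₁ x y)) =
      ∑ i, ballKernel ℓ y (x i) * min 1 (posDev ℓ ρ₁ θ₁ u₁ x y) := by
    intro y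
    unfold ballDens
    rcases Nat.eq_zero_or_pos m with hm | hm
    · subst hm; simp
    · rw [← mul_assoc, ← mul_assoc, mul_inv_cancel₀ (by exact_mod_cast hm.ne' : (m : ℝ) ≠ 0), one_mul, Finset.sum_mul]
  have hDi : Integrable fun y => (m : ℝ) * (ballDens ℓ x y * min 1 (posDev ℓ ρ₁ θ₁ u₁ x y)) := by
    have : (fun y => (m : ℝ) * (ballDens ℓ x y * min 1 (posDev ℓ ρ₁ θ₁ u₁ x y))) =
        fun y => ∑ i, ballKernel ℓ y (x i) * min 1 (posDev ℓ ρ₁ θ₁ u₁ x y) := funext hid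
    rw [this]
    exact integrable_finsetSum _ fun i _ => hLi i
  calc ∑ i, linWeight ℓ ρ₁ θ₁ u₁ x i = ∫ y, ∑ i, ballKernel ℓ y (x i) * min 1 (posDev ℓ ρ₁ θ₁ u₁ x y) := by
        unfold linWeight; rw [integral_finsetSum _ fun i _ => hLi i]
    _ = ∫ y, (m : ℝ) * (ballDens ℓ x y * min 1 (posDev ℓ ρ₁ θ₁ u₁ x y)) :=
        integral_congr_ae (ae_of_all _ fun y => (hid y).symm)
    _ ≤ ∫ y, (m : ℝ) * ((1 + ballDens ℓ x y) * min 1 (posDev ℓ ρ₁ θ₁ u₁ x y)) := by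
        refine integral_mono_of_nonneg (ae_of_all _ fun y => mul_nonneg (Nat.cast_nonneg m) (mul_nonneg (hρ0 y) (hmin0 y)))
          ?_ (ae_of_all _ fun y => mul_le_mul_of_nonneg_left
            (mul_le_mul_of_nonneg_right (by linarith [hρ0 y]) (hmin0 y)) (Nat.cast_nonneg m))
        refine ((integrable_const ((m : ℝ) * (1 + |(4 / 3 * Real.pi * ℓ ^ 3)⁻¹|))).mono' ?_ (ae_of_all _ fun y => ?_))
        · have hD : Measurable fun y => ballDens ℓ x y :=
            (Finset.measurable_sum _ fun i _ => wg_measurable_ballKernel measurable_id measurable_const ℓ).const_mul _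
          exact (((measurable_const.add hD).mul hPm1).const_mul _).aestronglyMeasurable
        · have hρB : ballDens ℓ x y ≤ |(4 / 3 * Real.pi * ℓ ^ 3)⁻¹| := by
            unfold ballDens
            have hm0 : 0 ≤ (m : ℝ)⁻¹ := inv_nonneg.2 (Nat.cast_nonneg m)
            calc (m : ℝ)⁻¹ * ∑ i, ballKernel ℓ y (x i) ≤ (m : ℝ)⁻¹ * ∑ _i : Fin m, |(4 / 3 * Real.pi * ℓ ^ 3)⁻¹| :=
                  mul_le_mul_of_nonneg_left (Finset.sum_le_sum fun i _ => wg_ballKernel_le ℓ y (x i)) hm0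
              _ = ((m : ℝ)⁻¹ * m) * |(4 / 3 * Real.pi * ℓ ^ 3)⁻¹| := by
                  rw [Finset.sum_const, Finset.card_univ, Fintype.card_fin, nsmul_eq_mul]; ring
              _ ≤ 1 * |(4 / 3 * Real.pi * ℓ ^ 3)⁻¹| := by
                  refine mul_le_mul_of_nonneg_right ?_ (abs_nonneg _)
                  rcases Nat.eq_zero_or_pos m with hm | hm
                  · subst hm; simp
                  · rw [inv_mul_cancel₀ (by exact_mod_cast hm.ne')]
              _ = _ := one_mul _
          rw [Real.norm_eq_abs, abs_of_nonneg (mul_nonneg (Nat.cast_nonneg m) (mul_nonneg (by linarith [hρ0 y]) (hmin0 y)))]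
          refine mul_le_mul_of_nonneg_left ?_ (Nat.cast_nonneg m)
          calc (1 + ballDens ℓ x y) * min 1 (posDev ℓ ρ₁ θ₁ u₁ x y) ≤ (1 + |(4 / 3 * Real.pi * ℓ ^ 3)⁻¹|) * 1 :=
                mul_le_mul (by linarith) (hmin1 y) (hmin0 y) (by positivity)
            _ = _ := mul_one _
    _ = m * smoothedDeviation ℓ ρ₁ θ₁ u₁ x := by rw [integral_const_mul, smoothedDeviation_eq]

/-! ## Crowded balls and the chessboard mesh -/

/-- **A crowded ball consists of crowded particles**: if the ball of radius `ℓ` about `y` holds more than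
`R' · m (4/3 π ℓ³)` particles (`R' ≥ max R 0`), each of its particles has more than `R · m ℓ³` particles within `12ℓ`.
[folklore] -/
theorem ball_subset_crowded {m : ℕ} {ℓ R R' : ℝ} (hℓ : 0 < ℓ) (hRR' : R ≤ R') (hR' : 0 ≤ R') (x : Fin m → T3) (y : T3)
    (hcrowd : R' * ((m : ℝ) * (4 / 3 * Real.pi * ℓ ^ 3)) < ((Finset.univ.filter fun i => Torus.euclidDist y (x i) < ℓ).card : ℝ))
    {i : Fin m} (hi : Torus.euclidDist y (x i) < ℓ) :
    R * ((m : ℝ) * ℓ ^ 3) < (nearCount (12 * ℓ) (x i) x : ℝ) := by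
  have hsub : (Finset.univ.filter fun j => Torus.euclidDist y (x j) < ℓ) ⊆
      (Finset.univ.filter fun j => Torus.euclidDist (x i) (x j) < 12 * ℓ) := by
    intro j hj
    simp only [Finset.mem_filter, Finset.mem_univ, true_and] at hj ⊢
    have htri := Literature.MathematicalPhysics.KineticTheory.euclidDist_triangle (x i) y (x j)
    rw [Torus.euclidDist_comm (x i) y] at htri
    linarith
  have hcard : ((Finset.univ.filter fun j => Torus.euclidDist y (x j) < ℓ).card : ℝ) ≤ (nearCount (12 * ℓ) (x i) x : ℝ) := by
    unfold nearCount
    exact_mod_cast Finset.card_le_card hsub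
  have hmono : R * ((m : ℝ) * ℓ ^ 3) ≤ R' * ((m : ℝ) * (4 / 3 * Real.pi * ℓ ^ 3)) := by
    have hmℓ : 0 ≤ (m : ℝ) * ℓ ^ 3 := by positivity
    have hπ : (1 : ℝ) ≤ 4 / 3 * Real.pi := by nlinarith [Real.pi_gt_three]
    calc R * ((m : ℝ) * ℓ ^ 3) ≤ R' * ((m : ℝ) * ℓ ^ 3) := mul_le_mul_of_nonneg_right hRR' hmℓ
      _ = R' * ((m : ℝ) * ℓ ^ 3) * 1 := (mul_one _).symm
      _ ≤ R' * ((m : ℝ) * ℓ ^ 3) * (4 / 3 * Real.pi) := mul_le_mul_of_nonneg_left hπ (mul_nonneg hR' hmℓ)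
      _ = R' * ((m : ℝ) * (4 / 3 * Real.pi * ℓ ^ 3)) := by ring
  linarith

/-- **Choice of the chessboard mesh**: for `0 < ℓ ≤ 1/8` there is an even `k > 0` with `2ℓ ≤ 1/k ≤ 4ℓ`
(`k = 2⌊1/(4ℓ)⌋`). [folklore] -/
theorem exists_even_mesh {ℓ : ℝ} (hℓ0 : 0 < ℓ) (hℓ : ℓ ≤ 1 / 8) :
    ∃ k : ℕ, 0 < k ∧ Even k ∧ 2 * ℓ ≤ (k : ℝ)⁻¹ ∧ (k : ℝ)⁻¹ ≤ 4 * ℓ := by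
  set q : ℝ := (4 * ℓ)⁻¹ with hq_def
  have h4ℓ : 0 < 4 * ℓ := by positivity
  have hq2 : 2 ≤ q := by
    rw [hq_def, le_inv_comm₀ two_pos h4ℓ]
    linarith
  have hq0 : 0 ≤ q := by linarith
  set n : ℕ := ⌊q⌋₊ with hn
  have hn1 : (1 : ℝ) ≤ n := by
    have : (1 : ℕ) ≤ n := Nat.le_floor (by norm_num; linarith)
    exact_mod_cast this
  have hnle : (n : ℝ) ≤ q := Nat.floor_le hq0
  have hnlt : q < n + 1 := Nat.lt_floor_add_one q
  have hn0 : (0 : ℝ) < 2 * n := by linarith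
  refine ⟨2 * n, by exact_mod_cast hn0, even_two_mul n, ?_, ?_⟩
  · push_cast
    rw [le_inv_comm₀ (by positivity) hn0]
    have e : (2 * ℓ)⁻¹ = 2 * q := by rw [hq_def, mul_inv, mul_inv]; ring
    rw [e]
    linarith
  · push_cast
    rw [inv_le_comm₀ hn0 h4ℓ, ← hq_def]
    linarith

end Summit.AtomisticToContinuum.HydrodynamicLimit.Theorems.NearConstantShortTimeHL

end
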